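import Summits.ValiantsHypothesis.ValiantsHypothesis.Theorems.GrenetZeonHessianRankCodimTwoLatinColour
import Summits.ValiantsHypothesis.ValiantsHypothesis.Theorems.GrenetZeonHessianRankCodimTwoLatinPlane
import HarnessLib

/-!
# The Latin block plane, `r = 0`: the pinned colouring model of the block values

Theorem P blueprint, file C1 (`Cruxes/HessianRankCodimTwo/GoodPlanesLatinReduction.md` §8).
`blockPoly p hp I J` is a sum over the permutations `π` of `Fin (3p)` with the two PINS
`π j₀ = i₀`, `π j₁ = i₁` (`i_s = blockIdx I s`, `j_s = blockIdx J s`) of the product of the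
variables `X_{dIdx (π i) i}` over `i ∉ {j₀, j₁}`.  Grouping by the colouring `blk ∘ π⁻¹` as in file
B1: the summand is `pinnedWeight I (colourOf π)` (product over the rows `∉ {i₀, i₁}`), the
colourings that occur are the balanced ones with `c i₀ = c i₁ = J`, all with equipotent fibres, so
`blockPoly p hp I J = N' • pinnedSum p hp I J` with `N' ≥ 1` (`blockPoly_eq_smul_pinnedSum`).
-/

noncomputable section

open MvPolynomial Finset
open Literature.Computability.AlgebraicComplexity

-- single-conjunct layout `Summits/ValiantsHypothesis/ValiantsHypothesis`: duplicated namespace by design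
set_option linter.dupNamespace false

namespace Summit.ValiantsHypothesis.ValiantsHypothesis.Theorems.GrenetZeonHessianRankCodimTwo

variable {p : ℕ}

/-- The weight of a colouring with the two pinned rows of block `I` removed. [folklore] -/
def pinnedWeight (p : ℕ) (hp : 2 ≤ p) (I : Fin 3) (c : Fin (3 * p + 0) → Fin 3) :
    MvPolynomial (Fin 3) ℤ :=
  ∏ r ∈ (Finset.univ.erase (blockIdx p 0 hp I 1)).erase (blockIdx p 0 hp I 0),
    X ⟨(c r + 2 * (blk p r).val) % 3, Nat.mod_lt _ (by norm_num)⟩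

/-- The pinned balanced colourings: balanced, and both pinned rows of block `I` coloured `J`.
[folklore] -/
def pinnedColourings (p : ℕ) (hp : 2 ≤ p) (I J : Fin 3) : Finset (Fin (3 * p + 0) → Fin 3) :=
  Finset.univ.filter fun c =>
    (∀ K : Fin 3, (Finset.univ.filter fun r => c r = K).card = p) ∧
      c (blockIdx p 0 hp I 0) = J ∧ c (blockIdx p 0 hp I 1) = J

/-- The sum of the pinned weights over the pinned balanced colourings. [folklore] -/
def pinnedSum (p : ℕ) (hp : 2 ≤ p) (I J : Fin 3) : MvPolynomial (Fin 3) ℤ :=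
  ∑ c ∈ pinnedColourings p hp I J, pinnedWeight p hp I c

/-- The pinned permutations. [folklore] -/
def pinnedPerms (p : ℕ) (hp : 2 ≤ p) (I J : Fin 3) : Finset (Equiv.Perm (Fin (3 * p + 0))) :=
  Finset.univ.filter fun π =>
    π (blockIdx p 0 hp J 1) = blockIdx p 0 hp I 1 ∧ π (blockIdx p 0 hp J 0) = blockIdx p 0 hp I 0

/-- The block of a representative index. [folklore] -/
theorem blk_blockIdx (hp : 2 ≤ p) (I : Fin 3) (s : Fin 2) : blk p (blockIdx p 0 hp I s) = I := by
  have h0 : 0 < p := by omega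
  apply Fin.ext
  rw [blk_val h0]
  have hs := s.isLt
  simp only [blockIdx]
  rw [show I.val * p + s.val = s.val + p * I.val by ring, Nat.add_mul_div_left _ _ h0,
    Nat.div_eq_of_lt (by omega), zero_add]

/-- `blockPoly` as a sum over the pinned permutations. [folklore] -/
theorem blockPoly_eq_sum_pinnedPerms (hp : 2 ≤ p) (I J : Fin 3) :
    blockPoly p hp I J = ∑ π ∈ pinnedPerms p hp I J,
      ∏ i ∈ (Finset.univ.erase (blockIdx p 0 hp J 1)).erase (blockIdx p 0 hp J 0),
        X (dIdx p (π i) i) := by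
  unfold blockPoly pinnedPerms
  rw [Finset.sum_filter]
  refine Finset.sum_congr rfl fun π _ => ?_
  have hne : blockIdx p 0 hp J 0 ≠ blockIdx p 0 hp J 1 := blockIdx_zero_ne_one hp J
  by_cases h : π (blockIdx p 0 hp J 1) = blockIdx p 0 hp I 1 ∧ π (blockIdx p 0 hp J 0) = blockIdx p 0 hp I 0
  · rw [if_pos ⟨h.1, hne, h.2⟩, if_pos h]
  · rw [if_neg (fun h' => h ⟨h'.1, h'.2.2⟩), if_neg h]

/-- The summand of `blockPoly` only depends on the colouring. [folklore] -/
theorem prod_X_dIdx_eq_pinnedWeight (hp : 2 ≤ p) (I J : Fin 3) {π : Equiv.Perm (Fin (3 * p + 0))}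
    (hπ : π ∈ pinnedPerms p hp I J) :
    ∏ i ∈ (Finset.univ.erase (blockIdx p 0 hp J 1)).erase (blockIdx p 0 hp J 0),
        (X (dIdx p (π i) i) : MvPolynomial (Fin 3) ℤ) = pinnedWeight p hp I (colourOf p π) := by
  have h0 : 0 < p := by omega
  simp only [pinnedPerms, Finset.mem_filter, Finset.mem_univ, true_and] at hπ
  unfold pinnedWeight
  refine Finset.prod_equiv π (fun i => ?_) (fun i hi => ?_)
  · simp only [Finset.mem_erase, Finset.mem_univ, and_true, ne_eq]
    rw [← hπ.1, ← hπ.2, π.injective.eq_iff, π.injective.eq_iff]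
  · congr 1
    apply Fin.ext
    simp only [dIdx, colourOf, Equiv.symm_apply_apply, blk_val h0]

/-- The colouring of a pinned permutation is pinned (and balanced). [folklore] -/
theorem colourOf_mem_pinnedColourings (hp : 2 ≤ p) (I J : Fin 3)
    {π : Equiv.Perm (Fin (3 * p + 0))} (hπ : π ∈ pinnedPerms p hp I J) :
    colourOf p π ∈ pinnedColourings p hp I J := by
  have h0 : 0 < p := by omega
  simp only [pinnedPerms, Finset.mem_filter, Finset.mem_univ, true_and] at hπ
  simp only [pinnedColourings, Finset.mem_filter, Finset.mem_univ, true_and]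
  refine ⟨balanced_colourOf h0 π, ?_, ?_⟩
  · rw [colourOf, ← hπ.2, Equiv.symm_apply_apply, blk_blockIdx]
  · rw [colourOf, ← hπ.1, Equiv.symm_apply_apply, blk_blockIdx]

/-- Right multiplication by a swap inside a block does not change the colouring. [folklore] -/
theorem colourOf_mul_swap (ρ : Equiv.Perm (Fin (3 * p + 0))) {a b : Fin (3 * p + 0)}
    (hab : blk p a = blk p b) : colourOf p (ρ * Equiv.swap a b) = colourOf p ρ := by
  funext r
  simp only [colourOf, Equiv.Perm.mul_def, Equiv.symm_trans_apply, Equiv.symm_swap]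
  rcases eq_or_ne (ρ.symm r) a with h | h
  · rw [h, Equiv.swap_apply_left, ← hab]
  rcases eq_or_ne (ρ.symm r) b with h' | h'
  · rw [h', Equiv.swap_apply_right, hab]
  · rw [Equiv.swap_apply_of_ne_of_ne h h']

/-- Every pinned balanced colouring comes from a pinned permutation. [folklore] -/
theorem exists_pinnedPerm (hp : 2 ≤ p) (I J : Fin 3) {c : Fin (3 * p + 0) → Fin 3}
    (hc : c ∈ pinnedColourings p hp I J) :
    ∃ π ∈ pinnedPerms p hp I J, colourOf p π = c := by
  have h0 : 0 < p := by omega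
  simp only [pinnedColourings, Finset.mem_filter, Finset.mem_univ, true_and] at hc
  obtain ⟨hbal, hc0, hc1⟩ := hc
  set i0 := blockIdx p 0 hp I 0
  set i1 := blockIdx p 0 hp I 1
  set j0 := blockIdx p 0 hp J 0
  set j1 := blockIdx p 0 hp J 1
  obtain ⟨ρ, hρ⟩ := exists_perm_colourOf_eq h0 hbal
  -- first pin: `j0 ↦ i0`
  have hj0' : blk p (ρ.symm i0) = blk p j0 := by
    rw [blk_blockIdx]; change colourOf p ρ i0 = J; rw [hρ, hc0]
  set ρ₂ := ρ * Equiv.swap j0 (ρ.symm i0) with hρ₂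
  have hρ₂c : colourOf p ρ₂ = c := by rw [hρ₂, colourOf_mul_swap ρ hj0'.symm, hρ]
  have hρ₂j0 : ρ₂ j0 = i0 := by
    rw [hρ₂, Equiv.Perm.mul_apply, Equiv.swap_apply_left, Equiv.apply_symm_apply]
  -- second pin: `j1 ↦ i1`
  have hj1' : blk p (ρ₂.symm i1) = blk p j1 := by
    rw [blk_blockIdx]; change colourOf p ρ₂ i1 = J; rw [hρ₂c, hc1]
  have hne1 : ρ₂.symm i1 ≠ j0 := by
    intro h
    have : i1 = i0 := by rw [← hρ₂j0, ← h, Equiv.apply_symm_apply]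
    exact blockIdx_zero_ne_one hp I this.symm
  set ρ₃ := ρ₂ * Equiv.swap j1 (ρ₂.symm i1) with hρ₃
  refine ⟨ρ₃, ?_, ?_⟩
  · simp only [pinnedPerms, Finset.mem_filter, Finset.mem_univ, true_and]
    constructor
    · change ρ₃ j1 = i1
      rw [hρ₃, Equiv.Perm.mul_apply, Equiv.swap_apply_left, Equiv.apply_symm_apply]
    · change ρ₃ j0 = i0
      rw [hρ₃, Equiv.Perm.mul_apply, Equiv.swap_apply_of_ne_of_ne (blockIdx_zero_ne_one hp J)
        (Ne.symm hne1), hρ₂j0]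
  · rw [hρ₃, colourOf_mul_swap ρ₂ hj1'.symm, hρ₂c]

/-- All pinned balanced colourings have equipotent fibres in the pinned permutations.
[folklore] -/
theorem card_fibre_pinned_eq (hp : 2 ≤ p) (I J : Fin 3) {c : Fin (3 * p + 0) → Fin 3}
    (hc : c ∈ pinnedColourings p hp I J) :
    ((pinnedPerms p hp I J).filter fun σ => colourOf p σ = c).card =
      ((pinnedPerms p hp J J).filter fun σ => colourOf p σ = blk p).card := by
  obtain ⟨ρ, hρP, hρ⟩ := exists_pinnedPerm hp I J hc
  simp only [pinnedPerms, Finset.mem_filter, Finset.mem_univ, true_and] at hρP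
  have hcol : ∀ σ : Equiv.Perm (Fin (3 * p + 0)), colourOf p (ρ⁻¹ * σ) = blk p ↔ colourOf p σ = c := by
    intro σ
    have h1 : ∀ r, colourOf p (ρ⁻¹ * σ) r = colourOf p σ (ρ r) := fun r => by
      simp [colourOf, Equiv.Perm.mul_def, Equiv.Perm.inv_def]
    constructor
    · intro h
      funext r
      have := congr_fun h (ρ.symm r)
      rw [h1, Equiv.apply_symm_apply] at this
      rw [this, ← hρ]
      rfl
    · intro h
      funext r
      rw [h1, h, ← hρ]
      simp [colourOf]
  refine Finset.card_bij (fun σ _ => ρ⁻¹ * σ) (fun σ hσ => ?_) (fun σ _ σ' _ h => ?_) (fun τ hτ => ?_)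
  · simp only [pinnedPerms, Finset.mem_filter, Finset.mem_univ, true_and] at hσ ⊢
    refine ⟨⟨?_, ?_⟩, (hcol σ).mpr hσ.2⟩
    · rw [Equiv.Perm.mul_apply, hσ.1.1, ← hρP.1]; simp
    · rw [Equiv.Perm.mul_apply, hσ.1.2, ← hρP.2]; simp
  · exact mul_left_cancel h
  · simp only [pinnedPerms, Finset.mem_filter, Finset.mem_univ, true_and] at hτ
    refine ⟨ρ * τ, ?_, by group⟩
    simp only [pinnedPerms, Finset.mem_filter, Finset.mem_univ, true_and]
    refine ⟨⟨?_, ?_⟩, ?_⟩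
    · rw [Equiv.Perm.mul_apply, hτ.1.1, hρP.1]
    · rw [Equiv.Perm.mul_apply, hτ.1.2, hρP.2]
    · have := (hcol (ρ * τ)).mp (by rw [← mul_assoc, inv_mul_cancel, one_mul]; exact hτ.2)
      exact this

/-- **The pinned colouring model of the block values**: `blockPoly = N' • pinnedSum`.
[folklore] -/
theorem blockPoly_eq_smul_pinnedSum (hp : 2 ≤ p) (I J : Fin 3) :
    blockPoly p hp I J = ((pinnedPerms p hp J J).filter fun σ => colourOf p σ = blk p).card •
      pinnedSum p hp I J := by
  classical
  rw [blockPoly_eq_sum_pinnedPerms, Finset.sum_congr rfl fun π hπ => prod_X_dIdx_eq_pinnedWeight hp I J hπ,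
    Finset.sum_comp (pinnedWeight p hp I) (colourOf p), pinnedSum, Finset.smul_sum]
  have himg : (pinnedPerms p hp I J).image (colourOf p) = pinnedColourings p hp I J := by
    ext c
    simp only [Finset.mem_image]
    constructor
    · rintro ⟨π, hπ, rfl⟩; exact colourOf_mem_pinnedColourings hp I J hπ
    · intro hc
      obtain ⟨π, hπ, h⟩ := exists_pinnedPerm hp I J hc
      exact ⟨π, hπ, h⟩
  rw [himg]
  refine Finset.sum_congr rfl fun c hc => ?_
  rw [card_fibre_pinned_eq hp I J hc]

/-- The multiplicity `N'` is positive. [folklore] -/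
theorem card_fibre_pinned_pos (hp : 2 ≤ p) (J : Fin 3) :
    0 < ((pinnedPerms p hp J J).filter fun σ => colourOf p σ = blk p).card :=
  Finset.card_pos.mpr ⟨1, by
    simp only [pinnedPerms, Finset.mem_filter, Finset.mem_univ, true_and, Equiv.Perm.one_apply]
    funext r
    change blk p ((Equiv.refl _).symm r) = blk p r
    rfl⟩

end Summit.ValiantsHypothesis.ValiantsHypothesis.Theorems.GrenetZeonHessianRankCodimTwo
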